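import Mathlib
import Summits.AnomalousDissipation.AnomalousDissipation.Theorems.SoloBlindT2Assembly

/-!
# (T2) face: the canonical landing member assembled from a certified box family and the two
# tail families (solo-blind, PLAN §82–§84, paper §24.68–§24.74)

Kernel #124 (`t2_assembly`) composes tail ⊕ box ⊕ tail with an AFFINE end-state bookkeeping
(`chart p + lift r`) and with SEPARATE Lipschitz constants for the box map and the defect map.
Two features of the actual certificate do not fit that form: the right matching rows of the box
problem (Robin row `β + G(Y) α`, F2 row `λ² M₂ + λ M₁ + M − P5(Y)`) are nonlinear in the end state,
and the contraction holds only in WEIGHTED row coordinates (label blindness: a unit change of a left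
row moves `α(b)` by `~10⁶`), i.e. for the composite matching map in scaled rows.  This file therefore

* re-derives the assembly from a bare matching hypothesis and a contraction hypothesis on the
  COMPOSITE map `defect ∘ box` (`t2_assembly_of_match`; the parameter space `P` carries no metric);
* instantiates everything for the inner landing system
  `α' = β, β' = (t + M) α, M' = M₁, M₁' = M₂, λ³ M₂' = M + (α²)''' = M + 2 (1 + M₁) α² + 8 (t + M) α β`
  on the state space `Fin 5 → ℝ` (coordinates `(α, β, M, M₁, M₂)`): the six weighted matching rows
  of the box problem (`matchRows`), the tail parameters read off a box solution (`tailParams`: left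
  `(c₀, s)` with `s = M₂(a) − ff₄(c₀)` the fast coordinate, right `(α, M, M₁)(b)`), the induced
  matching map (`tailDefect`), and the canonical asymptotic class at `−∞` (label functional
  `leftLabelFn`: transseries labels `(c₂, c₁) = (0, 0)`, i.e. `α² − ξ⁴/24 − 2 ξ log(−ξ) + 2 ξ → c₀`,
  together with `M, M₁, M₂ → 0`); at `+∞` the class is plain decay of all five coordinates;
* proves `t2_member`: a certified box family (K) on a complete set `s` of weighted row values
  (rows solved exactly, every solution pinned/positive as certified), a left tail family (L) pinned
  by the fast coordinate, a right tail family (R) pinned by `(α, M, M₁)(b)`, injectivity of the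
  right rows in the remaining coordinates `(β, M₂)` on a set containing all end states at `b`, and a
  contracting self-map `defect ∘ box` of `s`, yield a row value `r ∈ s` and a GLOBAL solution of the
  landing system which IS the certified box solution on `(a, b]` (so it inherits every box-certified
  property `Qbox`), carries the labels `(0, 0, c₀(r))` with `c₀(r) ∈ I` at `−∞`, decays at `+∞`,
  and has `α > 0` on all of `ℝ`.

All numerical constants (`λ`, `a = −X₁`, `b = X₂`, the weights `w`, the far-field chart `ff`, the
fast direction `v`, the Robin coefficient `G`, the F2 correction `P5`, the contraction constant)
are parameters; the hypotheses are what the interval certificates discharge: (K) = the stage-5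
Krawczyk run, (L) = lemma 24.71, (R) = lemma 24.72, injectivity + contraction = §24.74.
-/

namespace Summit.AnomalousDissipation.AnomalousDissipation.Theorems

open Set Filter Topology

section Abstract

/-- `t2_assembly` (kernel #124) with the bookkeeping abstracted away: a contracting self-map
`defect ∘ box` of a complete nonempty `s` has a fixed point (kernel #123), and it suffices that AT A
FIXED POINT the three pieces have equal states at `a` and at `b`; the parameter type `P` of the
tails needs no metric. -/
theorem t2_assembly_of_match {E P F : Type*} [MetricSpace E]
    [NormedAddCommGroup F] [NormedSpace ℝ F]
    (f : ℝ → F → F) {a b : ℝ} (hab : a < b)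
    {s : Set E} (hs : IsComplete s) (hne : s.Nonempty)
    (box : E → P) (defect : P → E) {K : NNReal}
    (hK : LipschitzOnWith K (defect ∘ box) s) (hmaps : MapsTo (defect ∘ box) s s) (hK1 : K < 1)
    (yB : E → ℝ → F) (yL yR : P → ℝ → F)
    (hB : ∀ r ∈ s, ∀ t, a ≤ t → t ≤ b → HasDerivAt (yB r) (f t (yB r t)) t)
    (hL : ∀ r ∈ s, ∀ t ≤ a, HasDerivAt (yL (box r)) (f t (yL (box r) t)) t)
    (hR : ∀ r ∈ s, ∀ t, b ≤ t → HasDerivAt (yR (box r)) (f t (yR (box r) t)) t)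
    (hmatch : ∀ r ∈ s, defect (box r) = r → yL (box r) a = yB r a ∧ yB r b = yR (box r) b) :
    ∃ r ∈ s, defect (box r) = r ∧
      (∀ t, HasDerivAt (assembledMember a b box yB yL yR r)
          (f t (assembledMember a b box yB yL yR r t)) t) ∧
      (∀ t ≤ a, assembledMember a b box yB yL yR r t = yL (box r) t) ∧
      (∀ t, a < t → t ≤ b → assembledMember a b box yB yL yR r t = yB r t) ∧
      (∀ t, b < t → assembledMember a b box yB yL yR r t = yR (box r) t) := by
  obtain ⟨r, hr, hfix⟩ : ∃ r ∈ s, defect (box r) = r := by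
    obtain ⟨r, hr, h⟩ := matching_fixedPoint hs hne (defect ∘ box) id hK
      (LipschitzWith.id.lipschitzOnWith) hmaps (by simpa using hK1)
    exact ⟨r, hr, h⟩
  obtain ⟨ha, hb'⟩ := hmatch r hr hfix
  exact ⟨r, hr, hfix,
    glue3_hasDerivAt f (yL (box r)) (yB r) (yR (box r)) a b hab (hL r hr) (hB r hr) (hR r hr)
      ha hb',
    fun t ht => glue3_eq_left _ _ _ hab ht, fun t hat htb => glue3_eq_box _ _ _ hat htb,
    fun t hbt => glue3_eq_right _ _ _ hbt⟩

end Abstract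

section LandingSystem

/-- The inner landing system as a first-order field on `y = (α, β, M, M₁, M₂)`:
`α' = β`, `β' = (t + M) α`, `M' = M₁`, `M₁' = M₂`,
`M₂' = (M + 2 (1 + M₁) α² + 8 (t + M) α β) / λ³` — the last line is `λ³ M''' = M + (α²)'''` with
`(α²)''' = 2 (1 + M') α² + 8 (t + M) α α'` expanded along the flow. -/
noncomputable def landingField (lam t : ℝ) (y : Fin 5 → ℝ) : Fin 5 → ℝ :=
  ![y 1, (t + y 2) * y 0, y 3, y 4,
    (y 2 + 2 * (1 + y 3) * y 0 ^ 2 + 8 * (t + y 2) * y 0 * y 1) / lam ^ 3]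

/-- The six WEIGHTED matching rows of the box problem at the end states `Ya` (at `ξ = a`) and
`Yb` (at `ξ = b`): four left rows `(Y_k(a) − ff_k(c₀) − (M₂(a) − ff₄(c₀)) v_k) / w_k` (distance to
the far-field chart `ff(c₀)` transversal to the fast direction `(v, 1)`), the Robin row
`(β(b) + G(Y(b)) α(b)) / w₄` and the F2 row `(λ² M₂(b) + λ M₁(b) + M(b) − P5(Y(b))) / w₅`. -/
noncomputable def matchRows (lam : ℝ) (w : Fin 6 → ℝ) (ff : ℝ → Fin 5 → ℝ) (v : Fin 4 → ℝ)
    (G P5 : (Fin 5 → ℝ) → ℝ) (c₀ : ℝ) (Ya Yb : Fin 5 → ℝ) : Fin 6 → ℝ :=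
  ![(Ya 0 - ff c₀ 0 - (Ya 4 - ff c₀ 4) * v 0) / w 0,
    (Ya 1 - ff c₀ 1 - (Ya 4 - ff c₀ 4) * v 1) / w 1,
    (Ya 2 - ff c₀ 2 - (Ya 4 - ff c₀ 4) * v 2) / w 2,
    (Ya 3 - ff c₀ 3 - (Ya 4 - ff c₀ 4) * v 3) / w 3,
    (Yb 1 + G Yb * Yb 0) / w 4,
    (lam ^ 2 * Yb 4 + lam * Yb 3 + Yb 2 - P5 Yb) / w 5]

/-- The right rows together with the pinned coordinates `(α, M, M₁)`; injectivity of this map on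
the region of interest says "the Robin and F2 rows determine `(β, M₂)` given `(α, M, M₁)`". -/
def rightKey (lam : ℝ) (G P5 : (Fin 5 → ℝ) → ℝ) (Y : Fin 5 → ℝ) : ℝ × ℝ × ℝ × ℝ × ℝ :=
  (Y 0, Y 2, Y 3, Y 1 + G Y * Y 0, lam ^ 2 * Y 4 + lam * Y 3 + Y 2 - P5 Y)

/-- Tail parameters read off the box solution with row value `r`: left `(c₀(r), s(r))` with
`s(r) = M₂(a) − ff₄(c₀(r))` the fast coordinate of the state at `a`; right `(α, M, M₁)(b)`. -/
def tailParams (a b : ℝ) (ff : ℝ → Fin 5 → ℝ) (c0 : (Fin 6 → ℝ) → ℝ)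
    (yB : (Fin 6 → ℝ) → ℝ → Fin 5 → ℝ) (r : Fin 6 → ℝ) : (ℝ × ℝ) × (ℝ × ℝ × ℝ) :=
  ((c0 r, yB r a 4 - ff (c0 r) 4), (yB r b 0, yB r b 2, yB r b 3))

/-- The matching map: the six weighted rows evaluated at the end states of the TAILS with
parameters `p` (left tail at `a`, right tail at `b`). The matched members are the fixed points of
`tailDefect ∘ tailParams`. -/
noncomputable def tailDefect (lam a b : ℝ) (w : Fin 6 → ℝ) (ff : ℝ → Fin 5 → ℝ) (v : Fin 4 → ℝ)
    (G P5 : (Fin 5 → ℝ) → ℝ) (yL : ℝ × ℝ → ℝ → Fin 5 → ℝ) (yR : ℝ × ℝ × ℝ → ℝ → Fin 5 → ℝ)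
    (p : (ℝ × ℝ) × (ℝ × ℝ × ℝ)) : Fin 6 → ℝ :=
  matchRows lam w ff v G P5 p.1.1 (yL p.1 a) (yR p.2 b)

/-- The left label functional `α² − ξ⁴/24 − 2 ξ log(−ξ) + 2 ξ` of a trajectory `y`: for the far-field
transseries `α² = ξ⁴/24 + c₂ ξ² + (c₁ − 2) ξ + 2 ξ log(−ξ) + c₀ + O(1/ξ)` (`ξ → −∞`) it tends to a
finite limit iff `(c₂, c₁) = (0, 0)`, and the limit is then `c₀` — the canonical labels `(0, 0, c₀)`.
(The accompanying condition `M, M₁, M₂ → 0`, i.e. `M = 2/ξ² + O(1/ξ³)`, is stated separately.) -/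
noncomputable def leftLabelFn (y : ℝ → Fin 5 → ℝ) (ξ : ℝ) : ℝ :=
  y ξ 0 ^ 2 - ξ ^ 4 / 24 - 2 * ξ * Real.log (-ξ) + 2 * ξ

/-- A closed box of row values in `Fin 6 → ℝ` is complete (this is how the admissible row set `s`
of `t2_member` is instantiated from the certificate). -/
theorem rowBox_isComplete (lo hi : Fin 6 → ℝ) : IsComplete (Icc lo hi) :=
  isClosed_Icc.isComplete

/-- Row bookkeeping: if the tails' rows equal the box's rows (same `c₀`, nonzero weights), the left
tail is pinned to the box's fast coordinate at `a`, the right tail to the box's `(α, M, M₁)` at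
`b`, and the right rows are injective in the remaining coordinates on a set containing both end
states at `b`, then the end states coincide. -/
theorem endStates_match {lam : ℝ} {w : Fin 6 → ℝ} (hw : ∀ k, w k ≠ 0) {ff : ℝ → Fin 5 → ℝ}
    {v : Fin 4 → ℝ} {G P5 : (Fin 5 → ℝ) → ℝ} {c₀ : ℝ} {Ya Yb Za Zb : Fin 5 → ℝ}
    {D : Set (Fin 5 → ℝ)}
    (hrows : matchRows lam w ff v G P5 c₀ Za Zb = matchRows lam w ff v G P5 c₀ Ya Yb)
    (hpinL : Za 4 = Ya 4) (hpinR : (Zb 0, Zb 2, Zb 3) = (Yb 0, Yb 2, Yb 3))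
    (hinj : InjOn (rightKey lam G P5) D) (hZ : Zb ∈ D) (hY : Yb ∈ D) :
    Za = Ya ∧ Yb = Zb := by
  have h0 := congrFun hrows 0
  have h1 := congrFun hrows 1
  have h2 := congrFun hrows 2
  have h3 := congrFun hrows 3
  have h4 := congrFun hrows 4
  have h5 := congrFun hrows 5
  simp only [matchRows, Matrix.cons_val_zero, Matrix.cons_val_one, Matrix.cons_val]
    at h0 h1 h2 h3 h4 h5
  rw [div_left_inj' (hw _)] at h0 h1 h2 h3 h4 h5
  rw [hpinL] at h0 h1 h2 h3
  simp only [Prod.mk.injEq] at hpinR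
  obtain ⟨e0, e2, e3⟩ := hpinR
  have hkey : rightKey lam G P5 Zb = rightKey lam G P5 Yb := by
    simp only [rightKey, Prod.mk.injEq]
    exact ⟨e0, e2, e3, h4, h5⟩
  refine ⟨?_, (hinj hZ hY hkey).symm⟩
  have e0 : Za 0 = Ya 0 := by linarith
  have e1 : Za 1 = Ya 1 := by linarith
  have e2 : Za 2 = Ya 2 := by linarith
  have e3 : Za 3 = Ya 3 := by linarith
  funext i
  fin_cases i
  · exact e0
  · exact e1
  · exact e2
  · exact e3
  · exact hpinL

/-- **(T2) — the canonical landing member from certified pieces.**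
Data: `λ`, matching points `a < b`, weights `w` (nonzero), far-field chart `ff`, fast direction
`v`, Robin coefficient `G`, F2 correction `P5`; a complete nonempty set `s` of weighted row values;
the box family `yB r` with its label `c0 r` (K); the left tail family `yL (c₀, s)` (L); the right
tail family `yR (α, M, M₁)` (R); a set `D` of end states on which the right rows are injective in
`(β, M₂)`; a property `Qbox` certified for every box solution on `(a, b]` (pins at `0`, enclosures).
Conclusion: some row value `r ∈ s` (with `c0 r ∈ I`) is matched, and the assembled function is a
global solution of the landing system, equal to the certified box solution on `(a, b]` (hence
`Qbox`), with canonical labels `(0, 0, c0 r)` at `−∞`, decaying at `+∞`, and with `α > 0` on `ℝ`. -/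
theorem t2_member {lam a b : ℝ} (hab : a < b) {w : Fin 6 → ℝ} (hw : ∀ k, w k ≠ 0)
    (ff : ℝ → Fin 5 → ℝ) (v : Fin 4 → ℝ) (G P5 : (Fin 5 → ℝ) → ℝ)
    {s : Set (Fin 6 → ℝ)} (hs : IsComplete s) (hne : s.Nonempty)
    (c0 : (Fin 6 → ℝ) → ℝ) (I : Set ℝ) (yB : (Fin 6 → ℝ) → ℝ → Fin 5 → ℝ)
    (yL : ℝ × ℝ → ℝ → Fin 5 → ℝ) (yR : ℝ × ℝ × ℝ → ℝ → Fin 5 → ℝ)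
    (D : Set (Fin 5 → ℝ)) (Qbox : ℝ → (Fin 5 → ℝ) → Prop) {K : NNReal}
    -- (K) the certified box family
    (hB : ∀ r ∈ s, ∀ t, a ≤ t → t ≤ b → HasDerivAt (yB r) (landingField lam t (yB r t)) t)
    (hBrows : ∀ r ∈ s, matchRows lam w ff v G P5 (c0 r) (yB r a) (yB r b) = r)
    (hBc0 : ∀ r ∈ s, c0 r ∈ I)
    (hBD : ∀ r ∈ s, yB r b ∈ D)
    (hBQ : ∀ r ∈ s, ∀ t, a < t → t ≤ b → Qbox t (yB r t))
    (hBpos : ∀ r ∈ s, ∀ t, a ≤ t → t ≤ b → 0 < yB r t 0)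
    -- (L) the left tail family, parametrised by `(c₀, s)` = `(tailParams … r).1`
    (hL : ∀ r ∈ s, ∀ t ≤ a, HasDerivAt (yL (tailParams a b ff c0 yB r).1)
      (landingField lam t (yL (tailParams a b ff c0 yB r).1 t)) t)
    (hLpin : ∀ r ∈ s, yL (tailParams a b ff c0 yB r).1 a 4 = yB r a 4)
    (hLlab : ∀ r ∈ s, Tendsto (leftLabelFn (yL (tailParams a b ff c0 yB r).1)) atBot (𝓝 (c0 r)))
    (hLdec : ∀ r ∈ s, Tendsto (fun ξ => (yL (tailParams a b ff c0 yB r).1 ξ 2,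
      yL (tailParams a b ff c0 yB r).1 ξ 3, yL (tailParams a b ff c0 yB r).1 ξ 4)) atBot (𝓝 0))
    (hLpos : ∀ r ∈ s, ∀ t ≤ a, 0 < yL (tailParams a b ff c0 yB r).1 t 0)
    -- (R) the right tail family, parametrised by `(α, M, M₁)(b)` = `(tailParams … r).2`
    (hR : ∀ r ∈ s, ∀ t, b ≤ t → HasDerivAt (yR (tailParams a b ff c0 yB r).2)
      (landingField lam t (yR (tailParams a b ff c0 yB r).2 t)) t)
    (hRpin : ∀ r ∈ s, (yR (tailParams a b ff c0 yB r).2 b 0, yR (tailParams a b ff c0 yB r).2 b 2,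
      yR (tailParams a b ff c0 yB r).2 b 3) = (yB r b 0, yB r b 2, yB r b 3))
    (hRD : ∀ r ∈ s, yR (tailParams a b ff c0 yB r).2 b ∈ D)
    (hRdec : ∀ r ∈ s, Tendsto (yR (tailParams a b ff c0 yB r).2) atTop (𝓝 0))
    (hRpos : ∀ r ∈ s, ∀ t, b ≤ t → 0 < yR (tailParams a b ff c0 yB r).2 t 0)
    -- the right rows determine `(β, M₂)` on `D`
    (hinj : InjOn (rightKey lam G P5) D)
    -- the matching map is a contracting self-map of `s` (weighted rows)
    (hK : LipschitzOnWith K (tailDefect lam a b w ff v G P5 yL yR ∘ tailParams a b ff c0 yB) s)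
    (hmaps : MapsTo (tailDefect lam a b w ff v G P5 yL yR ∘ tailParams a b ff c0 yB) s s)
    (hK1 : K < 1) :
    ∃ r ∈ s, c0 r ∈ I ∧ ∃ y : ℝ → Fin 5 → ℝ,
      (∀ t, HasDerivAt y (landingField lam t (y t)) t) ∧
      Tendsto (leftLabelFn y) atBot (𝓝 (c0 r)) ∧
      Tendsto (fun ξ => (y ξ 2, y ξ 3, y ξ 4)) atBot (𝓝 0) ∧
      Tendsto y atTop (𝓝 0) ∧ (∀ t, 0 < y t 0) ∧
      (∀ t, a < t → t ≤ b → y t = yB r t) ∧ (∀ t, a < t → t ≤ b → Qbox t (y t)) := by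
  set box := tailParams a b ff c0 yB with hbox
  set defect := tailDefect lam a b w ff v G P5 yL yR with hdefect
  have hmatch : ∀ r ∈ s, defect (box r) = r →
      yL (box r).1 a = yB r a ∧ yB r b = yR (box r).2 b := by
    intro r hr hfix
    have hrows : matchRows lam w ff v G P5 (c0 r) (yL (box r).1 a) (yR (box r).2 b) =
        matchRows lam w ff v G P5 (c0 r) (yB r a) (yB r b) := by
      have h1 : defect (box r) = matchRows lam w ff v G P5 (c0 r) (yL (box r).1 a)
          (yR (box r).2 b) := rfl
      rw [← h1, hfix, hBrows r hr]
    exact endStates_match hw hrows (hLpin r hr) (hRpin r hr) hinj (hRD r hr) (hBD r hr)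
  obtain ⟨r, hr, -, hderiv, hleft, hboxeq, hright⟩ :=
    t2_assembly_of_match (landingField lam) hab hs hne box defect hK hmaps hK1 yB
      (fun p => yL p.1) (fun p => yR p.2) hB hL hR hmatch
  refine ⟨r, hr, hBc0 r hr, assembledMember a b box yB (fun p => yL p.1) (fun p => yR p.2) r,
    hderiv, ?_, ?_, ?_, ?_, hboxeq, ?_⟩
  · -- the labels at -∞ are those of the left tail
    refine (hLlab r hr).congr' ?_
    filter_upwards [eventually_le_atBot a] with ξ hξ
    simp only [leftLabelFn, hleft ξ hξ]
  · refine (hLdec r hr).congr' ?_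
    filter_upwards [eventually_le_atBot a] with ξ hξ
    rw [hleft ξ hξ]
  · -- decay at +∞ is that of the right tail
    refine (hRdec r hr).congr' ?_
    filter_upwards [eventually_gt_atTop b] with t ht
    exact (hright t ht).symm
  · -- positivity of α, piece by piece
    intro t
    rcases le_or_gt t a with hta | hta
    · rw [hleft t hta]; exact hLpos r hr t hta
    rcases le_or_gt t b with htb | htb
    · rw [hboxeq t hta htb]; exact hBpos r hr t hta.le htb
    · rw [hright t htb]; exact hRpos r hr t htb.le
  · intro t hat htb
    rw [hboxeq t hat htb]
    exact hBQ r hr t hat htb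

/- Uniqueness of the matched row value in `s` is `matching_fixedPoint_unique` (kernel #123) applied
to the composite map; it is not needed for existence and is not restated. -/

end LandingSystem

end Summit.AnomalousDissipation.AnomalousDissipation.Theorems
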